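import Summits.ResolutionOfSingularities.ResolutionOfSingularities.Theorems.FrobeniusLadderFInjectiveMacaulayficationSingFullTower
import Summits.ResolutionOfSingularities.ResolutionOfSingularities.Theorems.FrobeniusLadderFInjectiveMacaulayficationTowerPersistenceKit
import HarnessLib

/-!
# K-SF-a / K-RR-a RECEIVERS BY NAME for v44 «SING TOWERS»: a recurrent SINGULAR (resp. non-FULL) chart family under the reduced-singular-locus recipe refutes
# `RegTower.SingTowerConjecture`'s (resp. `RegTower.SingFullTowerConjecture`'s) tower predicate at every floor containing it (crux `FInjectiveMacaulayfication`
# stmt-ResolutionOfSingularities-15315, chain w45a; res-L1-w45a-lead-1 g9; instantiation of `…TowerPersistenceKit` (p635381) at `c := RegTower.singCentre`, `hloc := singCentre_local`)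

[OURS · L1 W4.5a] Support file (`--supports stmt-ResolutionOfSingularities-15315 --as helper`); NOT a statement of any manuscript; def-free, fact-free, UNCONDITIONAL. AI-written (AI review is weaker
than expert review).

WHAT. The kit's receivers take `T`, `c`, `hloc` abstractly; here they are discharged for THE recipe of v44, so that a K-SF / K-RR loop certificate (tri-2's K-SF table j309588/j309924, toric scan
j309536: «a chart of floor n+r ≅ a chart of floor n under Sing_red») lands by ONE `exact` with only the certificate data (charts `U i`, one blowing up each along the chart's OWN reduced singular
locus, open immersions `U (next i) ⟶ B i`, one bad point per chart):
* `not_exists_recipeTowerFull_singCentre_of_recurrent_family₁` — FULL stop (kills `SingFullTowerConjecture` at an admissible floor containing some `U i`);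
* `not_exists_towerRegular_singCentre_of_recurrent_family₁` — REGULAR stop (kills `SingTowerConjecture p e 1` likewise).
`RegTower.singCentre p S` unfolds to `vanishingIdeal ⟨closure (Reg S)ᶜ⟩` by `rfl`, so `FullCentreDescent.singCentre_local` is its `hloc`. HONEST: receivers only — no certificate exists today
(K-SF v0 partial: no loop in 51 runs; toric scan running); nothing of the crux is proved or refuted.
[folklore assembly; cite: GortzWedhorn2020, Prop. 13.91 (2)]
-/

-- single-problem summit: the doubled namespace component is forced
set_option linter.dupNamespace false

noncomputable section

open AlgebraicGeometry CategoryTheory CategoryTheory.Limits Literature.AlgebraicGeometry.Resolution TopologicalSpace IsLocalRing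

namespace Summit.ResolutionOfSingularities.ResolutionOfSingularities.Theorems.FInjectiveMacaulayfication.RegTower

open Summit.ResolutionOfSingularities.ResolutionOfSingularities.Theorems.FInjectiveMacaulayfication
open SliceableCentre IntrinsicTower IntrinsicTower.Recipes FullCentreDescent

/-- `RegTower.singCentre p` is LOCAL for open immersions (literal `singCentre_local`). [folklore] -/
theorem singCentre_comap_of_isOpenImmersion (p : ℕ) {U S : Scheme.{0}} (j : U ⟶ S) [IsOpenImmersion j] :
    (singCentre p S).comap j = singCentre p U :=
  singCentre_local j

/-- ★ **K-SF-a RECEIVER**: a recurrent family of charts, each with a NON-FULL point, closed under «blow up the chart's reduced singular locus» up to open immersion, refutes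
`∃ n, RecipeTowerFull singCentre p n S` on every `S` containing an open copy of some chart — hence `SingFullTowerConjecture` if `S` is an admissible CM floor. [folklore assembly; OURS] -/
theorem not_exists_recipeTowerFull_singCentre_of_recurrent_family₁ (p : ℕ) {ι : Type} (U : ι → Scheme.{0})
    (hU : ∀ i, ∃ u : U i, ¬ FullCl p ((U i).presheaf.stalk u)) (next : ι → ι)
    (B : ι → Scheme.{0}) (π : ∀ i, B i ⟶ U i) (hπ : ∀ i, IsBlowup (π i) (singCentre p (U i))) (j : ∀ i, U (next i) ⟶ B i) (hj : ∀ i, IsOpenImmersion (j i))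
    (S : Scheme.{0}) (hS : ∃ (i : ι) (j : U i ⟶ S), IsOpenImmersion j) : ¬ ∃ n : ℕ, RecipeTowerFull singCentre p n S :=
  not_exists_fullTower_of_recurrent_family₁ p (RecipeTowerFull singCentre p) (singCentre p) (fun _ h => h) (fun _ _ h => h)
    (fun j _ => singCentre_local j) U hU next B π hπ j hj S hS

/-- ★ **K-RR-a RECEIVER**: a recurrent family of charts, each with a SINGULAR point, closed under «blow up the chart's reduced singular locus» up to open immersion, refutes
`∃ n, TowerRegular singCentre p n S` on every `S` containing an open copy of some chart — hence `SingTowerConjecture p e 1` if `S` is an admissible FULL floor. [folklore assembly; OURS] -/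
theorem not_exists_towerRegular_singCentre_of_recurrent_family₁ (p : ℕ) {ι : Type} (U : ι → Scheme.{0})
    (hU : ∀ i, ∃ u : U i, u ∉ Scheme.regularLocus (U i)) (next : ι → ι)
    (B : ι → Scheme.{0}) (π : ∀ i, B i ⟶ U i) (hπ : ∀ i, IsBlowup (π i) (singCentre p (U i))) (j : ∀ i, U (next i) ⟶ B i) (hj : ∀ i, IsOpenImmersion (j i))
    (S : Scheme.{0}) (hS : ∃ (i : ι) (j : U i ⟶ S), IsOpenImmersion j) : ¬ ∃ n : ℕ, TowerRegular singCentre p n S :=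
  not_exists_regularTower_of_recurrent_family₁ (TowerRegular singCentre p) (singCentre p) (fun _ h => h) (fun _ _ h => h)
    (fun j _ => singCentre_local j) U hU next B π hπ j hj S hS

end Summit.ResolutionOfSingularities.ResolutionOfSingularities.Theorems.FInjectiveMacaulayfication.RegTower

end
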